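import Literature.MathematicalPhysics.QuantumFieldTheory.Balaban1985CMP102.SectB

/-!
# Bałaban CMP 102 (1985) 255–275, AS-PRINTED SPINE — `SectBRemainder`: the SIZE of the printed remainder
# `Σ_{j<k} O((L^jε)^{3+κ₀})|T₁^{(j)}|` of (41) p. 266 / (47) p. 267 over the concrete carriers (`SectB.TowerObjects.Rm`):
# geometric in the depth below the unit scale, with a `K`-independent FLOOR at the unit scale — an ADDENDUM file
# (`SectB.lean` byte-stable; dot-notation extensions of `SectB.TowerObjects` declared from this file of the same directory)

Source: T. Bałaban, *Ultraviolet stability of three-dimensional lattice pure gauge field theories*, Commun. Math. Phys.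
**102** (1985) 255–275 [Balaban1985UV3] ([B10]; PDF page = journal page − 254; locators as in `Setting.lean`/`SectB.lean`).

WHAT [B10] PRINTS.  The exponents of (41) p. 266 L19–23 and (47) p. 267 L17–20 carry the remainder «Σ_{j=0}^{k−1}
O((L^jε)^{3+κ₀})|T₁^{(j)}|» with opposite signs (typed `SectB.TowerObjects.Rm W k = Σ_{j<k} rcoef_j·(L^jε)^{3+κ₀}·|T₁^{(j)}|`,
the `O(·)` constants `rcoef j` explicit), «κ₀ > 0» (p. 262 L1: the (3.24)-truncation at the sixth order leaves
«O(g₀⁷p¹⁸(g₀))|Ω₁| ≤ O(ε^{3+κ₀})|T₁|»), and «|T₁^{(k)}| = Σ_{y∈T₁^{(k)}} 1 = Σ_{x∈T_η} η³ = (L^kε)^{−3}|T_ε|» (p. 256 L39;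
`Scales.sites` = `B10.sitesRun`), «L^Kε = ε₀» (p. 256 L18, `Scales.hK`).

WHAT THIS FILE ADDS (cell `ym3-torus`, seat p1 gen 2; companion of `SectBRestricted.lean`, whose two-sided sandwich
`sandwich_of_restricted` has log-radius `Rm_k`).  PROVED arithmetic, nothing of the paper asserted:
`Rm_eq_volT_sum` — `Rm_k = |T_ε|·Σ_{j<k} rcoef_j·(L^jε)^{κ₀}`; (private) `sum_scale_rpow_le` — `Σ_{j<k}(L^jε)^κ ≤
(L^kε)^κ/(L^κ − 1)` (`κ > 0`); `Rm_le_geom` — `rcoef_j ≤ R` (`0 ≤ R`), `κ₀ > 0` ⇒ `Rm_k ≤ R·|T_ε|·(L^kε)^{κ₀}/(L^{κ₀} − 1)`; `Rm_le_height` — for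
`k ≤ K`, `Rm_k ≤ R·|T_ε|·ε₀^{κ₀}·((L^{κ₀})^{K−k})⁻¹/(L^{κ₀} − 1)`: GEOMETRICALLY SMALL IN THE DEPTH `K − k`; and the FLOOR
`Rm_ge_last` (`rcoef_j ≥ r ≥ 0`, `1 ≤ k` ⇒ `Rm_k ≥ r·|T_ε|·(L^{k−1}ε)^{κ₀}`), `Rm_unit_floor` (at `k = K ≥ 1`: `Rm_K ≥
r·|T_ε|·(ε₀/L)^{κ₀}`, INDEPENDENT OF `K`).  CONSEQUENCE RECORDED FOR THE CELL (not a statement about print): a two-sided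
(41)/(47) comparison read AT THE UNIT SCALE has a log-radius bounded below uniformly in the number of steps `K` (it is
dominated by the last steps, whose couplings `g_j ≈ gε₀^{1/2}` do not run to zero); read at a MOVING HEIGHT `k = h⋆(K)` with
`K − h⋆(K) → ∞` linearly (the cell's `h⋆ = K − ⌊K/4⌋`) it is `O(|T_ε|ε₀^{κ₀}(L^{κ₀})^{−⌊K/4⌋})`, summable in `K` — the
«moving height» device of the cell's nodes N5/N6.
-/

namespace Literature.MathematicalPhysics.QuantumFieldTheory.Balaban1985CMP102.SectB.TowerObjects

open Literature.MathematicalPhysics.QuantumFieldTheory.Balaban1983to89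
open Literature.MathematicalPhysics.QuantumFieldTheory.Balaban1985CMP102.Setting

variable {L : ℕ} {S : Scales L} {G : Type} [Balaban1983to89.GaugeGroup G] [MeasurableSpace G]
  [Balaban1983to89.HaarData G] (W : TowerObjects S G)

/-! ## §1 Plumbing over `Setting.Scales` -/

/-- `L ≥ 2 > 1` as a real number (from `Scales.hL`). Plumbing. [folklore] -/
private theorem one_lt_L (S : Scales L) : (1 : ℝ) < (L : ℝ) := by
  have := S.hL.2
  exact_mod_cast this

/-- `L^jε > 0`. Plumbing. [folklore] -/
private theorem scale_pos (j : ℕ) : 0 < (L : ℝ) ^ j * S.ε :=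
  mul_pos (pow_pos (lt_trans one_pos (one_lt_L S)) j) S.ε_pos

/-- `|T_ε| ≥ 0` ((3) p. 256: a sum of `ε³ > 0`). [cite: Balaban1985UV3, (3) p.256] -/
theorem volT_nonneg : 0 ≤ S.volT := by
  unfold Scales.volT
  exact Finset.sum_nonneg fun _ _ => pow_nonneg S.ε_pos.le 3

/-! ## §2 The remainder as a volume times a geometric scale sum -/

/-- **One term of the remainder**: `O((L^jε)^{3+κ₀})|T₁^{(j)}| = rcoef_j·|T_ε|·(L^jε)^{κ₀}`, since `|T₁^{(j)}| =
(L^jε)^{−3}|T_ε|` (p. 256 L39, `Scales.sites` = `B10.sitesRun`). [cite: Balaban1985UV3, (41) p.266 + (5) p.256] -/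
theorem Rm_term_eq (j : ℕ) :
    W.rcoef j * ((L : ℝ) ^ j * S.ε) ^ (3 + W.κ₀) * S.sites j
      = W.rcoef j * S.volT * ((L : ℝ) ^ j * S.ε) ^ W.κ₀ := by
  have hx := scale_pos (S := S) j
  unfold Scales.sites Balaban1983to89.B10.sitesRun
  rw [show (3 : ℝ) + W.κ₀ = ((3 : ℕ) : ℝ) + W.κ₀ by norm_num, Real.rpow_add hx, Real.rpow_natCast]
  have h3 : ((L : ℝ) ^ j * S.ε) ^ (3 : ℕ) * ((L : ℝ) ^ j * S.ε)⁻¹ ^ 3 = 1 := by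
    rw [inv_pow, mul_inv_cancel₀ (pow_ne_zero 3 hx.ne')]
  calc W.rcoef j * (((L : ℝ) ^ j * S.ε) ^ (3 : ℕ) * ((L : ℝ) ^ j * S.ε) ^ W.κ₀) *
        (((L : ℝ) ^ j * S.ε)⁻¹ ^ 3 * S.volT)
      = W.rcoef j * S.volT * ((L : ℝ) ^ j * S.ε) ^ W.κ₀ *
          (((L : ℝ) ^ j * S.ε) ^ (3 : ℕ) * ((L : ℝ) ^ j * S.ε)⁻¹ ^ 3) := by ring
    _ = W.rcoef j * S.volT * ((L : ℝ) ^ j * S.ε) ^ W.κ₀ := by rw [h3, mul_one]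

/-- **The remainder as a volume times a scale sum**: `Rm_k = |T_ε|·Σ_{j<k} rcoef_j·(L^jε)^{κ₀}`.
[cite: Balaban1985UV3, (41) p.266] -/
theorem Rm_eq_volT_sum (k : ℕ) :
    W.Rm k = S.volT * ∑ j ∈ Finset.range k, W.rcoef j * ((L : ℝ) ^ j * S.ε) ^ W.κ₀ := by
  unfold Rm
  rw [Finset.mul_sum]
  refine Finset.sum_congr rfl fun j _ => ?_
  rw [W.Rm_term_eq j]
  ring

/-- `(L^jε)^{κ₀} = (L^{κ₀})^j·ε^{κ₀}`. Plumbing. [folklore] -/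
private theorem scale_rpow (κ : ℝ) (j : ℕ) :
    ((L : ℝ) ^ j * S.ε) ^ κ = ((L : ℝ) ^ κ) ^ j * S.ε ^ κ := by
  have hL : (0 : ℝ) ≤ (L : ℝ) := Nat.cast_nonneg L
  rw [Real.mul_rpow (pow_nonneg hL j) S.ε_pos.le, ← Real.rpow_natCast ((L : ℝ) ^ κ) j,
    ← Real.rpow_mul hL, mul_comm κ, Real.rpow_mul hL, Real.rpow_natCast]

/-- **The scale sum is geometric**: for `κ > 0`, `Σ_{j<k} (L^jε)^κ ≤ (L^kε)^κ/(L^κ − 1)`. Plumbing. [folklore] -/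
private theorem sum_scale_rpow_le {κ : ℝ} (hκ : 0 < κ) (k : ℕ) :
    ∑ j ∈ Finset.range k, ((L : ℝ) ^ j * S.ε) ^ κ ≤ ((L : ℝ) ^ k * S.ε) ^ κ / ((L : ℝ) ^ κ - 1) := by
  simp_rw [scale_rpow (S := S) κ]
  have hq1 : 1 < (L : ℝ) ^ κ := Real.one_lt_rpow (one_lt_L S) hκ
  have hq0 : 0 < (L : ℝ) ^ κ - 1 := by linarith
  have hεκ : 0 ≤ S.ε ^ κ := Real.rpow_nonneg S.ε_pos.le κ
  rw [← Finset.sum_mul, geom_sum_eq hq1.ne']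
  have hle : ((L : ℝ) ^ κ) ^ k - 1 ≤ ((L : ℝ) ^ κ) ^ k := by linarith
  calc (((L : ℝ) ^ κ) ^ k - 1) / ((L : ℝ) ^ κ - 1) * S.ε ^ κ
      ≤ ((L : ℝ) ^ κ) ^ k / ((L : ℝ) ^ κ - 1) * S.ε ^ κ :=
        mul_le_mul_of_nonneg_right (div_le_div_of_nonneg_right hle hq0.le) hεκ
    _ = ((L : ℝ) ^ κ) ^ k * S.ε ^ κ / ((L : ℝ) ^ κ - 1) := by ring

/-- **THE REMAINDER IS GEOMETRICALLY SMALL IN THE HEIGHT**: if the printed `O(·)` constants satisfy `rcoef_j ≤ R`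
(`0 ≤ R`) and `κ₀ > 0` (p. 262 L1 «κ₀ > 0»), then `Rm_k ≤ R·|T_ε|·(L^kε)^{κ₀}/(L^{κ₀} − 1)` — the log-radius of the
sandwich `sandwich_of_restricted` at step `k`. [cite: Balaban1985UV3, (41) p.266 + p.262 L1] -/
theorem Rm_le_geom (k : ℕ) {R : ℝ} (hR : 0 ≤ R) (hr : ∀ j < k, W.rcoef j ≤ R) (hκ : 0 < W.κ₀) :
    W.Rm k ≤ R * S.volT * ((L : ℝ) ^ k * S.ε) ^ W.κ₀ / ((L : ℝ) ^ W.κ₀ - 1) := by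
  rw [W.Rm_eq_volT_sum k]
  have hV := volT_nonneg (S := S)
  have h1 : ∑ j ∈ Finset.range k, W.rcoef j * ((L : ℝ) ^ j * S.ε) ^ W.κ₀
      ≤ R * ∑ j ∈ Finset.range k, ((L : ℝ) ^ j * S.ε) ^ W.κ₀ := by
    rw [Finset.mul_sum]
    refine Finset.sum_le_sum fun j hj => ?_
    exact mul_le_mul_of_nonneg_right (hr j (Finset.mem_range.mp hj)) (Real.rpow_nonneg (scale_pos (S := S) j).le _)
  have h2 := sum_scale_rpow_le (S := S) hκ k
  calc S.volT * ∑ j ∈ Finset.range k, W.rcoef j * ((L : ℝ) ^ j * S.ε) ^ W.κ₀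
      ≤ S.volT * (R * (((L : ℝ) ^ k * S.ε) ^ W.κ₀ / ((L : ℝ) ^ W.κ₀ - 1))) :=
        mul_le_mul_of_nonneg_left (h1.trans (mul_le_mul_of_nonneg_left h2 hR)) hV
    _ = R * S.volT * ((L : ℝ) ^ k * S.ε) ^ W.κ₀ / ((L : ℝ) ^ W.κ₀ - 1) := by ring

/-- **In the depth below the unit scale**: with «L^Kε = ε₀» (p. 256 L18, `Scales.hK`), for `k ≤ K` one has `(L^kε)^{κ₀} =
ε₀^{κ₀}·(L^{κ₀})^{−(K−k)}`, so `Rm_k ≤ R·|T_ε|·ε₀^{κ₀}·((L^{κ₀})^{K−k})⁻¹/(L^{κ₀} − 1)` — summable along any height profile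
`k = h⋆(K)` with `K − h⋆(K) → ∞` linearly (the cell's `h⋆ = K − ⌊K/4⌋`). [cite: Balaban1985UV3, (41) p.266 + p.256 L18] -/
theorem Rm_le_height (k : ℕ) (hk : k ≤ S.K) {R : ℝ} (hR : 0 ≤ R) (hr : ∀ j < k, W.rcoef j ≤ R) (hκ : 0 < W.κ₀) :
    W.Rm k ≤ R * S.volT * (S.ε₀ ^ W.κ₀ * (((L : ℝ) ^ W.κ₀) ^ (S.K - k))⁻¹) / ((L : ℝ) ^ W.κ₀ - 1) := by
  have hL0 : (0 : ℝ) < (L : ℝ) := lt_trans one_pos (one_lt_L S)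
  have hLκ : 0 < (L : ℝ) ^ W.κ₀ := Real.rpow_pos_of_pos hL0 _
  have key : ((L : ℝ) ^ k * S.ε) ^ W.κ₀ = S.ε₀ ^ W.κ₀ * (((L : ℝ) ^ W.κ₀) ^ (S.K - k))⁻¹ := by
    have hsplit : (L : ℝ) ^ S.K * S.ε = (L : ℝ) ^ (S.K - k) * ((L : ℝ) ^ k * S.ε) := by
      rw [← mul_assoc, ← pow_add, Nat.sub_add_cancel hk]
    have hε₀ : S.ε₀ = (L : ℝ) ^ (S.K - k) * ((L : ℝ) ^ k * S.ε) := by rw [← S.hK, hsplit]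
    rw [hε₀, Real.mul_rpow (pow_nonneg hL0.le _) (scale_pos (S := S) k).le, ← Real.rpow_natCast ((L : ℝ) ^ W.κ₀),
      ← Real.rpow_mul hL0.le, mul_comm W.κ₀, Real.rpow_mul hL0.le, Real.rpow_natCast]
    have hne : ((L : ℝ) ^ (S.K - k)) ^ W.κ₀ ≠ 0 := (Real.rpow_pos_of_pos (pow_pos hL0 _) _).ne'
    rw [mul_comm (((L : ℝ) ^ (S.K - k)) ^ W.κ₀), mul_inv_cancel_right₀ hne]
  rw [← key]
  exact W.Rm_le_geom k hR hr hκ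

/-! ## §3 The floor at the unit scale -/

/-- **THE FLOOR**: if the printed `O(·)` constants are bounded BELOW, `rcoef_j ≥ r ≥ 0` for `j < k`, and `1 ≤ k`, then
`Rm_k ≥ r·|T_ε|·(L^{k−1}ε)^{κ₀}` (the last term alone). [cite: Balaban1985UV3, (41) p.266] -/
theorem Rm_ge_last (k : ℕ) (hk : 1 ≤ k) {r : ℝ} (hr0 : 0 ≤ r) (hr : ∀ j < k, r ≤ W.rcoef j) :
    r * S.volT * ((L : ℝ) ^ (k - 1) * S.ε) ^ W.κ₀ ≤ W.Rm k := by
  rw [W.Rm_eq_volT_sum k]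
  have hV := volT_nonneg (S := S)
  have hmem : k - 1 ∈ Finset.range k := Finset.mem_range.mpr (by omega)
  have hterm : r * ((L : ℝ) ^ (k - 1) * S.ε) ^ W.κ₀ ≤ W.rcoef (k - 1) * ((L : ℝ) ^ (k - 1) * S.ε) ^ W.κ₀ :=
    mul_le_mul_of_nonneg_right (hr (k - 1) (by omega)) (Real.rpow_nonneg (scale_pos (S := S) (k - 1)).le _)
  have hsingle : W.rcoef (k - 1) * ((L : ℝ) ^ (k - 1) * S.ε) ^ W.κ₀
      ≤ ∑ j ∈ Finset.range k, W.rcoef j * ((L : ℝ) ^ j * S.ε) ^ W.κ₀ :=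
    Finset.single_le_sum (f := fun j => W.rcoef j * ((L : ℝ) ^ j * S.ε) ^ W.κ₀)
      (fun j hj => mul_nonneg (hr0.trans (hr j (Finset.mem_range.mp hj)))
        (Real.rpow_nonneg (scale_pos (S := S) j).le _)) hmem
  calc r * S.volT * ((L : ℝ) ^ (k - 1) * S.ε) ^ W.κ₀ = S.volT * (r * ((L : ℝ) ^ (k - 1) * S.ε) ^ W.κ₀) := by ring
    _ ≤ S.volT * ∑ j ∈ Finset.range k, W.rcoef j * ((L : ℝ) ^ j * S.ε) ^ W.κ₀ :=
        mul_le_mul_of_nonneg_left (hterm.trans hsingle) hV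

/-- **THE UNIT-SCALE FLOOR IS INDEPENDENT OF `K`**: at the last step `k = K ≥ 1` («L^Kε = ε₀», p. 256 L18), `Rm_K ≥
r·|T_ε|·(ε₀/L)^{κ₀}` — the remainder of (41)/(47) AT THE UNIT LATTICE does not decrease with the number of steps (it is
dominated by the last steps, whose couplings `g_j ≈ gε₀^{1/2}` do not run to zero).  Consequence recorded for the cell: the
(41)/(47) sandwich is a summable-in-`K` comparison only at a moving height (`Rm_le_height`), never at the unit scale.
[cite: Balaban1985UV3, (41) p.266 + p.256 L18] -/
theorem Rm_unit_floor (hK : 1 ≤ S.K) {r : ℝ} (hr0 : 0 ≤ r) (hr : ∀ j < S.K, r ≤ W.rcoef j) :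
    r * S.volT * (S.ε₀ / (L : ℝ)) ^ W.κ₀ ≤ W.Rm S.K := by
  have hL0 : (0 : ℝ) < (L : ℝ) := lt_trans one_pos (one_lt_L S)
  have key : (L : ℝ) ^ (S.K - 1) * S.ε = S.ε₀ / (L : ℝ) := by
    rw [eq_div_iff hL0.ne', ← S.hK]
    rw [show (L : ℝ) ^ S.K = (L : ℝ) ^ (S.K - 1) * (L : ℝ) by rw [← pow_succ, Nat.sub_add_cancel hK]]
    ring
  rw [← key]
  exact W.Rm_ge_last S.K hK hr0 hr

end Literature.MathematicalPhysics.QuantumFieldTheory.Balaban1985CMP102.SectB.TowerObjects
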